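import Literature.AlgebraicGeometry.AbelianSchemes.AbelianSchemeTheoremOfCubeLocallyNoetherian
import Literature.AlgebraicGeometry.AbelianSchemes.AbelianSchemeQuotientMulNDescent
import HarnessLib

/-!
# `n^*L ≅ L^{(n²+n)/2} ⊗ (-1)^*L^{(n²-n)/2}` for an abelian scheme over a locally Noetherian base (Mumford §6 Cor. 3), unconditional

Layer `Literature/AlgebraicGeometry/AbelianSchemes`, namespace `Literature.AlgebraicGeometry.AbelianSchemes.AbelianSchemeOver`.
THEOREMS ONLY (no definition, no named fact, no instance, no notation, no `sorry`).  Cell `hodgecm-mathlib` (D-0151), F-DAG row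
F-2d, road (R-def) brick γ3 (author B-p07 (g17)): the first classical COROLLARY of the unconditional theorem of the cube over a
base (★ γ1/γ2 `cubeClass_eq_one(_of_isLocallyNoetherian)`).

SETTING.  `S` locally Noetherian (universe `0`, as ★ γ2), `A/S` an abelian scheme, `c ∈ Ȟ¹(A, 𝒪^×)` rigidified along the zero
section (`ε^*c = 1`), `x : T → A` a `T`-valued point (an element of the GROUP `Hom_S(T, A)`, Mathlib's `Hom.group` of the group
object `A.X`), `xⁿ`, `x⁻¹` its powers and inverse, `Λ(x, y) = (x·y)^*c·(x^*c)⁻¹·(y^*c)⁻¹` (★ `pullback_lift_mumfordClass`).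

* §1 `pullback_pow_succ_succ_mul_pullback_pow` — THE RECURSION `(x^{m+2})^*c · (x^m)^*c = ((x^{m+1})^*c)² · x^*c · (x⁻¹)^*c`:
  the cube ★ `cubeClass_eq_one_of_isLocallyNoetherian` at `(x^{m+1}, x, x⁻¹)` reads `Λ(x^{m+1}, x)·Λ(x^{m+1}, x⁻¹) = Λ(x^{m+1}, 1) = 1`
  ([MumfordAV1970] §6 Cor. 2 ⟹ Cor. 3, proof p. 59: apply the cube to `f = n_X`, `g = 1_X`, `h = (-1)_X`).
* §2 **`pullback_pow_left_eq` — [MumfordAV1970] §6 COR. 3 over a base, for every point**: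
  `(xⁿ)^*c = (x^*c)^{C(n+1, 2)} · ((x⁻¹)^*c)^{C(n, 2)}` in `Ȟ¹(T, 𝒪^×)` (`C(n+1,2) = (n²+n)/2`, `C(n,2) = (n²-n)/2`; two-step induction
  on the recursion); `pullback_pow_left_eq_of_symm` — `(xⁿ)^*c = (x^*c)^{n²}` when `(x⁻¹)^*c = x^*c`.
* §3 **`pullback_mulN_left_eq` — `[n]_A^*c = c^{C(n+1,2)} · ([-1]_A^*c)^{C(n,2)}`** in `Ȟ¹(A, 𝒪^×)` (the point `x = 𝟙_A`; ★ `mulN n =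
  (𝟙_A)ⁿ`, `(𝟙_A)⁻¹ = ι`), and `pullback_mulN_left_eq_of_symm` — **`[n]^*c = c^{n²}` for SYMMETRIC `c`** (`ι^*c = c`):
  [MumfordAV1970] §6 Cor. 3 «`n_X^*L ≅ L^{(n²+n)/2} ⊗ (-1)_X^*L^{(n²-n)/2}`; in particular `n_X^*L ≅ L^{n²}` if `L` is symmetric».
  Module forms `nonempty_pullback_mulN_iso_tensorPow_of_symm` are left to consumers (rank-one modules are classified by their
  classes, ★ `nonempty_iso_iff_detClass_eq`).

No dual pair, no reducedness, no connectedness of `S`; compare ★ `PoincareSheafMulN` (`[n]^*L ≅ L^{⊗n}` for `L ∈ Pic⁰`, reduced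
base).  HC_CM is proved only modulo the 7 printed citations until rung 0 closes; nothing here is about HC.

## References
* [MumfordAV1970] D. Mumford, *Abelian Varieties* (1970), §6 Cor. 2 (p. 58), Cor. 3 (p. 59).
* [MumfordFogartyKirwan1994] D. Mumford, J. Fogarty, F. Kirwan, *Geometric Invariant Theory*, 3rd ed. (1994), Ch. 6 §2
  Definition 6.2 (p. 120).
-/

set_option autoImplicit false

noncomputable section

set_option backward.isDefEq.respectTransparency false

open CategoryTheory CategoryTheory.Limits AlgebraicGeometry MonoidalCategory CartesianMonoidalCategory
open scoped MonObj

namespace Literature.AlgebraicGeometry.AbelianSchemes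

open Literature.AlgebraicGeometry.Motives Literature.AlgebraicGeometry.Modules
  Literature.AlgebraicGeometry.AbelianVarieties

namespace AbelianSchemeOver

/-! ## §0 Exponent bookkeeping: `C(n+1, 2) = n + C(n, 2)`, the recursion `F(m+2)·F(m) = F(m+1)²·a·b` -/

/-- `C(n+1, 2) = n + C(n, 2)` (Pascal). [folklore] -/
private theorem choose_two_succ (n : ℕ) : (n + 1).choose 2 = n + n.choose 2 := by
  rw [Nat.choose_succ_succ, Nat.choose_one_right]

/-- `C(m+2, 2) = (m+1) + C(m+1, 2)` (the same, with the numeral the induction produces). [folklore] -/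
private theorem choose_two_add_two (m : ℕ) : (m + 2).choose 2 = (m + 1) + (m + 1).choose 2 :=
  choose_two_succ (m + 1)

/-- `C(n+1, 2) + C(n, 2) = n²`. [folklore] -/
private theorem choose_two_succ_add_choose_two (n : ℕ) : (n + 1).choose 2 + n.choose 2 = n ^ 2 := by
  induction n with
  | zero => simp
  | succ n ih =>
    rw [choose_two_succ (n + 1)]
    rw [choose_two_succ n] at ih ⊢
    have hsq : (n + 1) ^ 2 = n ^ 2 + 2 * n + 1 := by ring
    omega

/-- **The solution of the recursion `F(m+2)·F(m) = F(m+1)²·a·b`, `F(0) = 1`, `F(1) = a`** in a commutative group: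
`F(n) = a^{C(n+1,2)}·b^{C(n,2)}` (two-step induction; `C(m+3,2) + C(m+1,2) = 2·C(m+2,2) + 1`). [folklore] -/
private theorem eq_pow_choose_of_recursion {G : Type*} [CommGroup G] (F : ℕ → G) (a b : G) (h0 : F 0 = 1) (h1 : F 1 = a)
    (hrec : ∀ m, F (m + 2) * F m = F (m + 1) ^ 2 * a * b) (n : ℕ) :
    F n = a ^ (n + 1).choose 2 * b ^ n.choose 2 := by
  induction n using Nat.twoStepInduction with
  | zero => simp [h0]
  | one => simp [h1]
  | more m ih0 ih1 =>
    have h := hrec m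
    rw [ih0, ih1] at h
    have e1 : (m + 2 + 1).choose 2 + (m + 1).choose 2 = (m + 2).choose 2 * 2 + 1 := by
      rw [choose_two_succ (m + 2), choose_two_add_two m]; omega
    have e2 : (m + 2).choose 2 + m.choose 2 = (m + 1).choose 2 * 2 + 1 := by
      rw [choose_two_add_two m, choose_two_succ m]; omega
    calc F (m + 2)
        = F (m + 2) * (a ^ (m + 1).choose 2 * b ^ m.choose 2) * (a ^ (m + 1).choose 2 * b ^ m.choose 2)⁻¹ := by
          rw [mul_inv_cancel_right]
      _ = (a ^ (m + 2).choose 2 * b ^ (m + 1).choose 2) ^ 2 * a * b * (a ^ (m + 1).choose 2 * b ^ m.choose 2)⁻¹ := by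
          rw [h]
      _ = a ^ (m + 2 + 1).choose 2 * b ^ (m + 2).choose 2 := by
          rw [mul_inv_eq_iff_eq_mul, mul_mul_mul_comm (a ^ (m + 2 + 1).choose 2), ← pow_add, ← pow_add, e1, e2, mul_pow,
            ← pow_mul, ← pow_mul, mul_assoc, mul_mul_mul_comm, ← pow_succ, ← pow_succ]

variable {S : Scheme.{0}} [IsLocallyNoetherian S] (A : AbelianSchemeOver S) (c : CechPic A.left)
  (hc : CechPic.pullback A.unitSection c = 1)

/-! ## §1 The recursion from the cube at `(x^{m+1}, x, x⁻¹)` -/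

set_option maxHeartbeats 400000 in
include hc in
/-- **`(x^{m+2})^*c · (x^m)^*c = ((x^{m+1})^*c)² · x^*c · (x⁻¹)^*c`** in `Ȟ¹(T, 𝒪^×)`: the cube (★ `cubeClass_eq_one_of_isLocallyNoetherian`)
at the points `(x^{m+1}, x, x⁻¹)` says `Λ(x^{m+1}, x)·Λ(x^{m+1}, x⁻¹) = Λ(x^{m+1}, x·x⁻¹) = Λ(x^{m+1}, 1) = 1`, while
`Λ(x^{m+1}, x) = (x^{m+2})^*c·((x^{m+1})^*c)⁻¹·(x^*c)⁻¹` and `Λ(x^{m+1}, x⁻¹) = (x^m)^*c·((x^{m+1})^*c)⁻¹·((x⁻¹)^*c)⁻¹`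
(★ `pullback_lift_mumfordClass`) — [MumfordAV1970] §6, proof of Cor. 3 («apply Cor. 2 with `f = n_X`, `g = 1_X`, `h = (-1)_X`»).
[cite: MumfordAV1970, §6 Cor. 3 (p. 59)] -/
theorem pullback_pow_succ_succ_mul_pullback_pow {T : Over S} (x : T ⟶ A.X) (m : ℕ) :
    CechPic.pullback (x ^ (m + 2)).left c * CechPic.pullback (x ^ m).left c =
      CechPic.pullback (x ^ (m + 1)).left c ^ 2 * CechPic.pullback x.left c * CechPic.pullback x⁻¹.left c := by
  have h2 : x ^ (m + 1) * x = x ^ (m + 2) := (pow_succ x (m + 1)).symm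
  have h0 : x ^ (m + 1) * x⁻¹ = x ^ m := by rw [pow_succ, mul_inv_cancel_right]
  have key := A.cubeClass_eq_one_of_isLocallyNoetherian c hc (x ^ (m + 1)) x x⁻¹
  rw [mul_inv_cancel, A.pullback_lift_one_right_mumfordClass c hc, one_mul, A.pullback_lift_mumfordClass,
    A.pullback_lift_mumfordClass, h2, h0, ← mul_inv, inv_eq_one] at key
  -- `key : (f₂·f₁⁻¹·a⁻¹)·(f₀·f₁⁻¹·b⁻¹) = 1` with `fᵢ = (x^{m+i})^*c`, `a = x^*c`, `b = (x⁻¹)^*c`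
  rw [← mul_inv_eq_one, ← key]
  simp only [pow_two, mul_inv_rev, mul_assoc, mul_comm, mul_left_comm]

/-! ## §2 Mumford's Cor. 3 at every point: `(xⁿ)^*c = (x^*c)^{C(n+1,2)} · ((x⁻¹)^*c)^{C(n,2)}` -/

include hc in
/-- **[MumfordAV1970] §6 COROLLARY 3 over a locally Noetherian base, at every `T`-valued point**: for `c ∈ Ȟ¹(A, 𝒪^×)` rigidified
along the zero section and `x : T → A` over `S`, `(xⁿ)^*c = (x^*c)^{C(n+1,2)} · ((x⁻¹)^*c)^{C(n,2)}` in `Ȟ¹(T, 𝒪^×)` —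
«`n^*L ≅ L^{(n²+n)/2} ⊗ (-1)^*L^{(n²-n)/2}`» read at the point `x` (`C(n+1,2) = (n²+n)/2`, `C(n,2) = (n²-n)/2`); two-step induction
on §1 with `(x⁰)^*c = 1^*c = 1` (rigidification, ★ `pullback_one_left`). No dual pair, no reducedness/connectedness of the base.
[cite: MumfordAV1970, §6 Cor. 3 (p. 59)] -/
theorem pullback_pow_left_eq {T : Over S} (x : T ⟶ A.X) (n : ℕ) :
    CechPic.pullback (x ^ n).left c =
      CechPic.pullback x.left c ^ (n + 1).choose 2 * CechPic.pullback x⁻¹.left c ^ n.choose 2 :=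
  eq_pow_choose_of_recursion (fun k => CechPic.pullback (x ^ k).left c) _ _
    (by rw [pow_zero, A.pullback_one_left c hc]) (by rw [pow_one]) (A.pullback_pow_succ_succ_mul_pullback_pow c hc x) n

include hc in
/-- **The SYMMETRIC case at a point**: if `(x⁻¹)^*c = x^*c` then `(xⁿ)^*c = (x^*c)^{n²}` (`C(n+1,2) + C(n,2) = n²`).
[cite: MumfordAV1970, §6 Cor. 3 (p. 59)] -/
theorem pullback_pow_left_eq_of_symm {T : Over S} (x : T ⟶ A.X) (hx : CechPic.pullback x⁻¹.left c = CechPic.pullback x.left c)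
    (n : ℕ) : CechPic.pullback (x ^ n).left c = CechPic.pullback x.left c ^ (n ^ 2) := by
  rw [A.pullback_pow_left_eq c hc x n, hx, ← pow_add, choose_two_succ_add_choose_two]

/-! ## §3 `[n]^*c = c^{(n²+n)/2} · ([-1]^*c)^{(n²-n)/2}`; `[n]^*c = c^{n²}` for symmetric `c` -/

include hc in
/-- **[MumfordAV1970] §6 COROLLARY 3 over a locally Noetherian base — `[n]_A^*c = c^{C(n+1,2)} · ([-1]_A^*c)^{C(n,2)}`** in
`Ȟ¹(A, 𝒪^×)` for every `c` rigidified along the zero section («for all `L` … `n_X^*L ≅ L^{(n²+n)/2} ⊗ (-1)_X^*L^{(n²-n)/2}`»):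
§2 at the universal point `x = 𝟙_A` (`[n]_A = (𝟙_A)ⁿ`, ★ `mulN`; `[-1]_A = (𝟙_A)⁻¹ = ι`). No dual pair, base possibly non-reduced
and disconnected. [cite: MumfordAV1970, §6 Cor. 3 (p. 59)] -/
theorem pullback_mulN_left_eq (n : ℕ) :
    CechPic.pullback (A.mulN n).left c = c ^ (n + 1).choose 2 * CechPic.pullback (ι[A.X]).left c ^ n.choose 2 := by
  have key := A.pullback_pow_left_eq c hc (𝟙 A.X) n
  rw [Over.id_left, CechPic.pullback_id_apply, ← GrpObj.inv_eq_inv] at key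
  exact key

include hc in
/-- **`[n]_A^*c = c^{n²}` for SYMMETRIC `c`** (`ι^*c = c`, i.e. `(-1)^*L ≅ L`) over a locally Noetherian base — [MumfordAV1970] §6
Cor. 3 «in particular `n_X^*L ≅ L^{n²}` if `L` is symmetric». [cite: MumfordAV1970, §6 Cor. 3 (p. 59)] -/
theorem pullback_mulN_left_eq_of_symm (hsymm : CechPic.pullback (ι[A.X]).left c = c) (n : ℕ) :
    CechPic.pullback (A.mulN n).left c = c ^ (n ^ 2) := by
  rw [A.pullback_mulN_left_eq c hc n, hsymm, ← pow_add, choose_two_succ_add_choose_two]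

end AbelianSchemeOver

end Literature.AlgebraicGeometry.AbelianSchemes

end
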